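import Literature.AnabelianGeometry.EtaleTheta.Discharge.Sec2AutKNormalizersX
import Literature.AnabelianGeometry.EtaleTheta.Discharge.Sec2AutKDihedral

/-!
# [EtTh] Remark 2.6.1 on the profinite side: the quotients `Π_{C̲}/Π_{C̲̲} ≅ ℤ/lℤ` and
# `Π_{C̲}/Π_{X̲̲} ≅ ℤ/lℤ × ℤ/2ℤ` (proof-only companion)

Mochizuki, *The Étale Theta Function …* [EtTh], Publ. RIMS 45 (2009), §2, Remark 2.6.1, PRIMS text
p.40 (printed p.266; locators = PDF pages; bib key `MochizukiEtTh2009`): "`Aut_K(X̲̲^log) = μ_l × {±1}`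
… `Aut_K(C̲̲^log) = μ_l`" [cite: MochizukiEtTh2009, Rmk 2.6.1 p.40].

Cell abc-iut, layer L2, discharge seat abc-iut-L2-d3 (node EtTh:Rmk2.6.1); continuation of
`Sec2AutKNormalizersX.lean`. For construction data `(H' = Π_{C̲}, E, S, ι̲)` of `Π_{C̲̲} = ⟨S·E, ι̲⟩` over
`X : CoverDataAx l`, under `μ_l ⊆ K` (`hmu`) and the printed definition of `Δ̄_Θ` (`hΘ`, p.35):

* `sup_zpowers_inf_barTheta_eq` — `Π_{C̲̲} ∩ Δ̄_Θ`-preimage `= Ker`;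
* `nonempty_barTheta_quot_mulEquiv_of_cyclic`, `barTheta_cyclic_of_commutator` — `Δ̄_Θ ≅ ℤ/lℤ` from the
  instance-free cyclicity hypothesis `∃ t, Δ̄_Θ-preimage ⊆ t^ℤ·Ker` ("`Δ̄_Θ ≅ (ℤ/lℤ)(1)`", p.35), itself a
  consequence of `hΘ`;
* `nonempty_quot_sup_zpowers_mulEquiv_of_cyclic` / `…_mulEquiv` — **`Π_{C̲}/Π_{C̲̲} ≅ Δ̄_Θ ≅ ℤ/lℤ`**
  ("`Aut_K(C̲̲) = μ_l`") under cyclicity / under `hΘ`;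
* `nonempty_quot_inf_PiX_mulEquiv` — `Π_{C̲}/Π_{X̲} ≅ ℤ/2ℤ`;
* `nonempty_quot_sup_eigen_mulEquiv` — **`Π_{C̲}/Π_{X̲̲} ≅ ℤ/lℤ × ℤ/2ℤ`** ("`Aut_K(X̲̲) = μ_l × {±1}`"), via
  the two projections `Π_{C̲}/Π_{X̲̲} → Π_{C̲}/Π_{C̲̲} × Π_{C̲}/Π_{X̲}` (`Π_{C̲̲} ∩ Π_{X̲} = Π_{X̲̲}`, Prop 2.2 (iii)).

No new definition, no named fact; nothing asserts that a `CoverDataAx` exists; no side is taken on any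
disputed claim.
-/

namespace Literature.AnabelianGeometry.EtaleTheta

namespace ThetaCovers

namespace CoverDataAx

open scoped commutatorElement

universe u

variable {l : ℕ} (X : CoverDataAx.{u} l)

section Data

variable {H' E S : Subgroup X.PiC} {ι : X.PiC}

/-- `Π_{C̲̲} ∩ Δ̄_Θ`-preimage `= Ker`: `Π_{C̲̲} ∩ Π_{X̲} = S·E` (Prop 2.2 (iii)), `(S·E) ∩ Δ_C = E` (Prop 2.2 (ii)),
`E ∩ Δ̄_Θ`-preimage `= Ker`. [cite: MochizukiEtTh2009, Prop 2.2 (iii) p.37] -/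
theorem sup_zpowers_inf_barTheta_eq (hH' : X.toCoverData.IsTypeLTorsPm H')
    (hι : X.toCoverData.IsInversion H' ι) (h2 : ι * ι ∈ X.barKer)
    (hE : X.toCoverData.IsMinusEigen (H' ⊓ X.PiX) H' ι E) (hS : X.toCoverData.IsSplitting S) :
    ((S ⊔ E) ⊔ Subgroup.zpowers ι) ⊓ X.barTheta = X.barKer := by
  have hT := hH'.inf_isTypeLTors
  refine le_antisymm ?_ (le_inf (hS.barKer_le.trans (le_sup_left.trans le_sup_left))
    X.barKer_le_barTheta)
  rintro x ⟨hxP, hxT⟩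
  have hxR : x ∈ S ⊔ E := by
    rw [← X.sup_zpowers_inf_eq hH' rfl hι hE hS h2]
    exact ⟨hxP, hT.barTheta_le hxT⟩
  have hxE : x ∈ E := by
    rw [← X.splitting_sup_eigen_inf_deltaC hH' rfl hE hS]
    exact ⟨hxR, (X.barTheta_le hxT).2⟩
  rw [← hE.inf_eq]
  exact ⟨hxE, hxT⟩

/-- **`Δ̄_Θ ≅ ℤ/lℤ` from cyclicity** ("`Δ̄_Θ ≅ (ℤ/lℤ)(1)`", p.35), instance-free form of the hypothesis:
`Δ̄_Θ`-preimage `⊆ t^ℤ·Ker` for some `t` — then `Δ̄_Θ`-preimage`/Ker` is cyclic of order `l` (`[Δ̄_Θ-preimage : Ker] = l`).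
[cite: MochizukiEtTh2009, Def 2.1 p.35] -/
theorem nonempty_barTheta_quot_mulEquiv_of_cyclic
    (hcyc : ∃ t ∈ X.barTheta, X.barTheta ≤ Subgroup.zpowers t ⊔ X.barKer) :
    haveI : (X.barKer.subgroupOf X.barTheta).Normal := X.barKer_normal.subgroupOf _
    Nonempty (↥X.barTheta ⧸ X.barKer.subgroupOf X.barTheta ≃* Multiplicative (ZMod l)) := by
  haveI := X.barKer_normal
  haveI : (X.barKer.subgroupOf X.barTheta).Normal := X.barKer_normal.subgroupOf _
  obtain ⟨t, ht, hgen⟩ := hcyc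
  set g : ↥X.barTheta ⧸ X.barKer.subgroupOf X.barTheta := QuotientGroup.mk ⟨t, ht⟩ with hg
  have hall : ∀ q : ↥X.barTheta ⧸ X.barKer.subgroupOf X.barTheta, q ∈ Subgroup.zpowers g := by
    intro q
    induction q using QuotientGroup.induction_on with
    | H s =>
      obtain ⟨a, ha, u, hu, hau⟩ := Subgroup.mem_sup_of_normal_right.mp (hgen s.2)
      obtain ⟨k, rfl⟩ := Subgroup.mem_zpowers_iff.mp ha
      have : (QuotientGroup.mk s : ↥X.barTheta ⧸ X.barKer.subgroupOf X.barTheta) = g ^ k := by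
        rw [hg, ← QuotientGroup.mk_zpow, eq_comm, QuotientGroup.eq, Subgroup.mem_subgroupOf]
        change ((⟨t, ht⟩ ^ k : ↥X.barTheta) : X.PiC)⁻¹ * s ∈ X.barKer
        rw [Subgroup.coe_zpow, ← hau, inv_mul_cancel_left]
        exact hu
      rw [this]
      exact Subgroup.zpow_mem _ (Subgroup.mem_zpowers g) k
  have hcard : Nat.card (↥X.barTheta ⧸ X.barKer.subgroupOf X.barTheta) = l := X.relIndex_barKer
  exact ⟨(zmodMulEquivOfGenerator hall hcard).symm⟩

/-- The printed definition `hΘ : [Δ_X, Δ_X]·Ker = Δ̄_Θ`-preimage implies the cyclicity of `Δ̄_Θ` in the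
instance-free form (generator: the commutator `[u, g]` of `Sec2AutKPairing`; needs a `Π_{X̲}` of type
`(1, l-tors)` to name `u, g`). [cite: MochizukiEtTh2009, Def 2.1 p.35] -/
theorem barTheta_cyclic_of_commutator (hΘ : ⁅X.DeltaX, X.DeltaX⁆ ⊔ X.barKer = X.barTheta)
    {H : Subgroup X.PiC} (hT : X.toCoverData.IsTypeLTors H) :
    ∃ t ∈ X.barTheta, X.barTheta ≤ Subgroup.zpowers t ⊔ X.barKer := by
  haveI := X.barKer_normal
  obtain ⟨φ, hφs, hφk⟩ := hT.quot
  obtain ⟨u, g, hu, -, hgΔ, -, hdec⟩ := X.exists_generators hT φ hφs hφk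
  have hdec' : ∀ d : X.PiC, d ∈ X.DeltaX → ∃ (n : ℕ) (k : ℤ) (t : X.PiC), t ∈ X.barTheta ∧
      d = u ^ n * (g ^ k * t) := fun d hd => by
    obtain ⟨n, k, t, ht, h1, -⟩ := hdec d hd
    exact ⟨n, k, t, ht, h1⟩
  have hzp := X.map_barTheta_eq_zpowers hΘ hu hgΔ hdec'
  refine ⟨⁅u, g⁆, X.commutator_deltaX_le_barTheta (Subgroup.commutator_mem_commutator hu hgΔ),
    fun s hs => ?_⟩
  have hms : (QuotientGroup.mk' X.barKer s) ∈ X.barTheta.map (QuotientGroup.mk' X.barKer) :=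
    ⟨s, hs, rfl⟩
  rw [hzp] at hms
  obtain ⟨k, hk⟩ := Subgroup.mem_zpowers_iff.mp hms
  rw [QuotientGroup.mk'_apply, ← QuotientGroup.mk_zpow, QuotientGroup.eq] at hk
  exact Subgroup.mem_sup_of_normal_right.mpr ⟨⁅u, g⁆ ^ k, Subgroup.zpow_mem _ (Subgroup.mem_zpowers _) k,
    (⁅u, g⁆ ^ k)⁻¹ * s, hk, by rw [mul_inv_cancel_left]⟩

/-- **`Π_{C̲}/Π_{C̲̲} ≅ ℤ/lℤ`** ("`Aut_K(C̲̲^log) = μ_l`"): `Π_{C̲} = Π_{C̲̲}·Δ̄_Θ`, so the inclusion of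
`Δ̄_Θ`-preimage induces `Δ̄_Θ`-preimage`/Ker ≅ Π_{C̲}/Π_{C̲̲}`, and `Δ̄_Θ ≅ ℤ/lℤ` by cyclicity ("`Δ̄_Θ ≅ (ℤ/lℤ)(1)`",
p.35, hypothesis `hcyc` in instance-free form; the normality of `Π_{C̲̲}` in `Π_{C̲}` is `μ_l ⊆ K`,
`le_normalizer_sup_zpowers`). [cite: MochizukiEtTh2009, Rmk 2.6.1 p.40] -/
theorem nonempty_quot_sup_zpowers_mulEquiv_of_cyclic
    (hcyc : ∃ t ∈ X.barTheta, X.barTheta ≤ Subgroup.zpowers t ⊔ X.barKer)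
    (hH' : X.toCoverData.IsTypeLTorsPm H') (hι : X.toCoverData.IsInversion H' ι) (h2 : ι * ι ∈ X.barKer)
    (hE : X.toCoverData.IsMinusEigen (H' ⊓ X.PiX) H' ι E) (hS : X.toCoverData.IsSplitting S)
    [hP : (((S ⊔ E) ⊔ Subgroup.zpowers ι).subgroupOf H').Normal] :
    Nonempty (↥H' ⧸ ((S ⊔ E) ⊔ Subgroup.zpowers ι).subgroupOf H' ≃* Multiplicative (ZMod l)) := by
  haveI := X.barTheta_normal
  haveI : (X.barKer.subgroupOf X.barTheta).Normal := X.barKer_normal.subgroupOf _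
  have hT := hH'.inf_isTypeLTors
  set P : Subgroup X.PiC := (S ⊔ E) ⊔ Subgroup.zpowers ι with hPdef
  have hPT : P ⊔ X.barTheta = H' := X.sup_zpowers_sup_barTheta_eq hH' hι hE hS
  have hTle : X.barTheta ≤ H' := hT.barTheta_le.trans inf_le_left
  have hPle : P ≤ H' := by rw [← hPT]; exact le_sup_left
  -- `Δ̄_Θ`-preimage `→ Π_{C̲}/Π_{C̲̲}`
  let ψ : X.barTheta →* ↥H' ⧸ P.subgroupOf H' :=
    (QuotientGroup.mk' (P.subgroupOf H')).comp (Subgroup.inclusion hTle)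
  have hψ : ∀ t : X.barTheta, ψ t = QuotientGroup.mk (Subgroup.inclusion hTle t) := fun t => rfl
  have hsurj : Function.Surjective ψ := by
    intro q
    induction q using QuotientGroup.induction_on with
    | H x =>
      have hx : (x : X.PiC) ∈ X.barTheta ⊔ P := by rw [sup_comm, hPT]; exact x.2
      obtain ⟨t, ht, p, hp, htp⟩ := Subgroup.mem_sup_of_normal_left.mp hx
      refine ⟨⟨t, ht⟩, ?_⟩
      rw [hψ, QuotientGroup.eq, Subgroup.mem_subgroupOf]
      change (t : X.PiC)⁻¹ * x ∈ P
      rw [← htp, inv_mul_cancel_left]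
      exact hp
  have hker : ψ.ker = X.barKer.subgroupOf X.barTheta := by
    ext t
    rw [MonoidHom.mem_ker, hψ, QuotientGroup.eq_one_iff, Subgroup.mem_subgroupOf,
      Subgroup.mem_subgroupOf, ← X.sup_zpowers_inf_barTheta_eq hH' hι h2 hE hS]
    change (t : X.PiC) ∈ P ↔ (t : X.PiC) ∈ P ⊓ X.barTheta
    exact ⟨fun h => ⟨h, t.2⟩, fun h => h.1⟩
  obtain ⟨e⟩ := X.nonempty_barTheta_quot_mulEquiv_of_cyclic hcyc
  exact ⟨(QuotientGroup.liftEquiv (φ := ψ) _ hsurj hker.symm).symm.trans e⟩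

/-- **`Π_{C̲}/Π_{C̲̲} ≅ ℤ/lℤ`** under the printed definition `hΘ : [Δ_X, Δ_X]·Ker = Δ̄_Θ`-preimage of `Δ̄_Θ`
(which gives the cyclicity). [cite: MochizukiEtTh2009, Rmk 2.6.1 p.40] -/
theorem nonempty_quot_sup_zpowers_mulEquiv (hΘ : ⁅X.DeltaX, X.DeltaX⁆ ⊔ X.barKer = X.barTheta)
    (hH' : X.toCoverData.IsTypeLTorsPm H') (hι : X.toCoverData.IsInversion H' ι) (h2 : ι * ι ∈ X.barKer)
    (hE : X.toCoverData.IsMinusEigen (H' ⊓ X.PiX) H' ι E) (hS : X.toCoverData.IsSplitting S)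
    [hP : (((S ⊔ E) ⊔ Subgroup.zpowers ι).subgroupOf H').Normal] :
    Nonempty (↥H' ⧸ ((S ⊔ E) ⊔ Subgroup.zpowers ι).subgroupOf H' ≃* Multiplicative (ZMod l)) :=
  X.nonempty_quot_sup_zpowers_mulEquiv_of_cyclic (X.barTheta_cyclic_of_commutator hΘ hH'.inf_isTypeLTors)
    hH' hι h2 hE hS

/-- `Π_{C̲}/Π_{X̲} ≅ ℤ/2ℤ` (`[Π_{C̲} : Π_{X̲}] = 2`). [cite: MochizukiEtTh2009, Def 2.1 p.36] -/
theorem nonempty_quot_inf_PiX_mulEquiv (hH' : X.toCoverData.IsTypeLTorsPm H')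
    [hN : ((H' ⊓ X.PiX).subgroupOf H').Normal] :
    Nonempty (↥H' ⧸ (H' ⊓ X.PiX).subgroupOf H' ≃* Multiplicative (ZMod 2)) := by
  haveI : Fact (Nat.Prime 2) := ⟨Nat.prime_two⟩
  have h1 : Nat.card (↥H' ⧸ (H' ⊓ X.PiX).subgroupOf H') = 2 := hH'.relIndex_two
  have h2 : Nat.card (Multiplicative (ZMod 2)) = 2 := by
    rw [Nat.card_eq_fintype_card, Fintype.card_multiplicative, ZMod.card]
  exact ⟨mulEquivOfPrimeCardEq h1 h2⟩

/-- **`Π_{C̲}/Π_{X̲̲} ≅ ℤ/lℤ × ℤ/2ℤ`** ("`Aut_K(X̲̲^log) = μ_l × {±1}`"): the two projections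
`Π_{C̲}/Π_{X̲̲} → Π_{C̲}/Π_{C̲̲} × Π_{C̲}/Π_{X̲}` form an injection (`Π_{C̲̲} ∩ Π_{X̲} = Π_{X̲̲}`, Prop 2.2 (iii))
between groups of order `2l` (`[Π_{C̲} : Π_{X̲̲}] = 2l`), hence an isomorphism; under `μ_l ⊆ K`
(normality of `Π_{X̲̲}`, `Π_{C̲̲}` in `Π_{C̲}`) and the printed definition `hΘ` of `Δ̄_Θ`.
[cite: MochizukiEtTh2009, Rmk 2.6.1 p.40] -/
theorem nonempty_quot_sup_eigen_mulEquiv (hΘ : ⁅X.DeltaX, X.DeltaX⁆ ⊔ X.barKer = X.barTheta)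
    (hH' : X.toCoverData.IsTypeLTorsPm H') (hι : X.toCoverData.IsInversion H' ι) (h2 : ι * ι ∈ X.barKer)
    (hE : X.toCoverData.IsMinusEigen (H' ⊓ X.PiX) H' ι E) (hS : X.toCoverData.IsSplitting S)
    [hR : ((S ⊔ E).subgroupOf H').Normal] [hP : (((S ⊔ E) ⊔ Subgroup.zpowers ι).subgroupOf H').Normal] :
    Nonempty (↥H' ⧸ (S ⊔ E).subgroupOf H' ≃*
      Multiplicative (ZMod l) × Multiplicative (ZMod 2)) := by
  haveI : NeZero l := ⟨by obtain ⟨k, hk⟩ := X.l_odd; omega⟩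
  have hT := hH'.inf_isTypeLTors
  haveI hN : ((H' ⊓ X.PiX).subgroupOf H').Normal := (X.inf_PiX_normal hH' hι).subgroupOf _
  set P : Subgroup X.PiC := (S ⊔ E) ⊔ Subgroup.zpowers ι with hPdef
  set R : Subgroup X.PiC := S ⊔ E with hRdef
  have hPT : P ⊔ X.barTheta = H' := X.sup_zpowers_sup_barTheta_eq hH' hι hE hS
  have hPle : P ≤ H' := by rw [← hPT]; exact le_sup_left
  have hRH : R ≤ H' ⊓ X.PiX := by
    rw [← X.sup_eigen_sup_barTheta_eq' hH' hE hS]; exact le_sup_left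
  have hPR : P ⊓ (H' ⊓ X.PiX) = R := X.sup_zpowers_inf_eq hH' rfl hι hE hS h2
  -- the two projections
  let φ : ↥H' →* (↥H' ⧸ P.subgroupOf H') × (↥H' ⧸ (H' ⊓ X.PiX).subgroupOf H') :=
    (QuotientGroup.mk' (P.subgroupOf H')).prod (QuotientGroup.mk' ((H' ⊓ X.PiX).subgroupOf H'))
  have hφker : φ.ker = R.subgroupOf H' := by
    ext x
    rw [MonoidHom.mem_ker, MonoidHom.prod_apply, Prod.mk_eq_one, QuotientGroup.mk'_apply,
      QuotientGroup.mk'_apply, QuotientGroup.eq_one_iff, QuotientGroup.eq_one_iff,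
      Subgroup.mem_subgroupOf, Subgroup.mem_subgroupOf, Subgroup.mem_subgroupOf, ← hPR]
    simp only [Subgroup.mem_inf]
  let Φ := QuotientGroup.lift (R.subgroupOf H') φ hφker.ge
  have hinj : Function.Injective Φ :=
    (QuotientGroup.injective_lift_iff (R.subgroupOf H') φ hφker.ge).mpr hφker.symm
  -- cardinalities: `[H' : R] = 2l = [H' : P]·[H' : H' ∩ Π_X]`
  have hRHidx : R.relIndex (H' ⊓ X.PiX) = l := X.index_typeLTorsTheta H' E S ι hH' hE hS
  have hRP : R.relIndex P = 2 := X.relIndex_sup_zpowers hH' rfl hι hE hS h2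
  have hcardR : Nat.card (↥H' ⧸ R.subgroupOf H') = l * 2 := by
    change R.relIndex H' = l * 2
    rw [← Subgroup.relIndex_mul_relIndex R (H' ⊓ X.PiX) H' hRH inf_le_left, hRHidx, hH'.relIndex_two]
  have hcardP : Nat.card (↥H' ⧸ P.subgroupOf H') = l := by
    change P.relIndex H' = l
    have h := Subgroup.relIndex_mul_relIndex R P H' le_sup_left hPle
    rw [hRP, show R.relIndex H' = l * 2 from hcardR] at h
    omega
  have hcard2 : Nat.card (↥H' ⧸ (H' ⊓ X.PiX).subgroupOf H') = 2 := hH'.relIndex_two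
  haveI : Finite (↥H' ⧸ P.subgroupOf H') :=
    Nat.finite_of_card_ne_zero (by rw [hcardP]; exact NeZero.ne l)
  haveI : Finite (↥H' ⧸ (H' ⊓ X.PiX).subgroupOf H') :=
    Nat.finite_of_card_ne_zero (by rw [hcard2]; norm_num)
  have hbij : Function.Bijective Φ := by
    rw [Nat.bijective_iff_injective_and_card]
    refine ⟨hinj, ?_⟩
    rw [hcardR, Nat.card_prod, hcardP, hcard2]
  obtain ⟨e1⟩ := X.nonempty_quot_sup_zpowers_mulEquiv hΘ hH' hι h2 hE hS
  obtain ⟨e2⟩ := X.nonempty_quot_inf_PiX_mulEquiv hH'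
  exact ⟨(MulEquiv.ofBijective Φ hbij).trans (MulEquiv.prodCongr e1 e2)⟩

end Data

end CoverDataAx

end ThetaCovers

end Literature.AnabelianGeometry.EtaleTheta
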